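import Mathlib
import Summits.NavierStokesRegularity.NavierStokesRegularity.Theorems.TaoLadderRungTwoBreakOneShiftWindowSensStepD
import HarnessLib

/-!
# The one-shift window system, LXXIII: THE TWO-RUN TAIL-SENSITIVITY STEP WITH ROW MASKS — the wake (`B`) and top (`E`)
# tail differences kept SEPARATE: one Boolean `PairStepD.sensOKM mW mT pB ZB pE ZE` (two K–Z vector fixed points with the
# MASKED twin sources `src · [mW]`, `src · [mT]`) that yields, for two runs of two realisations whose factors are twins at the
# ROW-WISE distance `B·[mW] + E·[mT]` and which start `|S_u(0) − S_v(0)|_i ≤ pB_i B + pE_i E` apart: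
# `|S_u(t) − S_v(t)|_i ≤ (pB_i + ZB_i) B + (pE_i + ZE_i) E` on the step (cell harvest/h2-tao-ladder, seat p2;
# rung1/RUNG1-P2G16-REPORT.md §83 (K2: β_b and β_e supported on the edge rows); support for K1(1) = `NoSurvivingDSSOne`,
# stmt-NavierStokesRegularity-20205)

MODEL lattice ODEs only (Tao 2016 §4 normal form on Tao's shift set `S`); nothing here is a statement about
the Navier–Stokes equations; no item is closed; no instance is evaluated here. Generic in `ι`, `κ`; COMPUTATIONAL
(referee P162) once an instance's Booleans are evaluated by `native_decide`.

* `abs_termField_twin_sub_le_row` — part LXVII's field-difference bound with the twin hypothesis only on the terms of the row;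
* `PairStepD.sensOKM`, `PairStepD.of_sensOKM`, **`PairStepD.abs_sensM_le`** (part XVII `abs_stepSensitivity_le` with
  `cb := src·[mW]`, `ce := src·[mT]`, the rough rows / weights / direction of part XXXIV).
-/

-- the sub-problem namespace repeats the summit name by design (D-0017)
set_option linter.dupNamespace false

namespace Summit.NavierStokesRegularity.NavierStokesRegularity.Theorems

namespace DSSOneShift

open Set Finset Metric Filter Topology TopologicalSpace
open Literature.Analysis.ODE
open Summit.NavierStokesRegularity.NavierStokesRegularity.Theorems.TaylorModelCert
open Summit.NavierStokesRegularity.NavierStokesRegularity.Theorems.TaylorModelReadout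
open Summit.NavierStokesRegularity.NavierStokesRegularity.Theorems.CertificateGlueOn

/-! ### The field difference with a row-wise twin hypothesis -/

section Row

variable {ι : Type*} [Fintype ι] [DecidableEq ι] {κ : Type*} [Fintype κ] {n : ℕ} (e : ι ≃ Fin n)
  {Tc T₁ T₂ : κ → BTerm ι}

omit [Fintype ι] [DecidableEq ι] [Fintype κ] in
/-- One row of the twin difference is `δ ·` a member of `srcRow` (twin hypothesis on the row's terms only). [folklore] -/
theorem exists_mem_srcRow_row (prec : ℕ) {δ : ℝ} (hδ : 0 ≤ δ) {X : Array IntervalD} {x : ι → ℝ}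
    (hx : ∀ i, IntervalD.mem (x i) (IntervalD.aget X (e i))) :
    ∀ {dl : List RTermD} {kl : List κ}, List.Forall₂ (fun d k => TermOK e d (Tc k) (T₁ k)) dl kl →
      List.Forall₂ (fun d k => TermOK e d (Tc k) (T₂ k)) dl kl →
      (∀ k ∈ kl, Factor.Twin δ (T₁ k).fa (T₂ k).fa ∧ Factor.Twin δ (T₁ k).fb (T₂ k).fb) →
      ∃ r : ℝ, IntervalD.mem r (srcRow prec X dl) ∧
        (kl.map fun k => (Tc k).coef * ((T₁ k).fa.val x * (T₁ k).fb.val x - (T₂ k).fa.val x * (T₂ k).fb.val x)).sum = δ * r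
  | _, _, List.Forall₂.nil, _, _ => ⟨0, by simpa [srcRow] using IntervalD.mem_ofInt 0, by simp⟩
  | _, _, List.Forall₂.cons (a := d) (b := k) h hl, h2, ht => by
    obtain ⟨h', hl'⟩ := List.forall₂_cons.1 h2
    obtain ⟨hq, -, hfa, hfb⟩ := h
    obtain ⟨-, -, hfa', hfb'⟩ := h'
    have htk := ht k (List.mem_cons_self)
    obtain ⟨ha1, ha2, θa, hθa, hda⟩ := twin_vals e hδ hfa hfa' htk.1 hx
    obtain ⟨hb1, hb2, θb, hθb, hdb⟩ := twin_vals e hδ hfb hfb' htk.2 hx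
    obtain ⟨r, hr, hsum⟩ := exists_mem_srcRow_row prec hδ hx hl hl' (fun k' hk' => ht k' (List.mem_cons_of_mem _ hk'))
    refine ⟨(Tc k).coef * (θa * (T₁ k).fb.val x + (T₂ k).fa.val x * θb) + r, ?_, ?_⟩
    · rw [srcRow]
      exact IntervalD.mem_addR prec (IntervalD.mem_mulR prec hq (IntervalD.mem_addR prec
        (IntervalD.mem_mulR prec hθa hb1) (IntervalD.mem_mulR prec ha2 hθb))) hr
    · rw [List.map_cons, List.sum_cons, hsum]
      have e1 : (T₁ k).fa.val x * (T₁ k).fb.val x - (T₂ k).fa.val x * (T₂ k).fb.val x =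
          ((T₁ k).fa.val x - (T₂ k).fa.val x) * (T₁ k).fb.val x +
            (T₂ k).fa.val x * ((T₁ k).fb.val x - (T₂ k).fb.val x) := by ring
      rw [e1, hda, hdb]
      ring

omit [Fintype ι] in
/-- **THE TWIN FIELD DIFFERENCE BOUND, ROW-WISE HYPOTHESIS**: as part LXVII `abs_termField_twin_sub_le`, but the factors
need to be twins at distance `δ` only on the terms of row `i`. [cite: KapelaZgliczynski2009, §4 (perturbation size); Moore1979, §3.2; cell vocabulary, harvest/h2-tao-ladder rung1/RUNG1-P2G16-REPORT.md §83] -/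
theorem abs_termField_twin_sub_le_row {rows : ι → List κ} {RD : RRows} (h₁ : IsRTEncl e Tc T₁ rows RD)
    (h₂ : IsRTEncl e Tc T₂ rows RD) {δ : ℝ} (hδ : 0 ≤ δ) (i : ι)
    (ht : ∀ k ∈ rows i, Factor.Twin δ (T₁ k).fa (T₂ k).fa ∧ Factor.Twin δ (T₁ k).fb (T₂ k).fb) (prec : ℕ)
    {X : Array IntervalD} {x : ι → ℝ} (hx : ∀ i, IntervalD.mem (x i) (IntervalD.aget X (e i))) :
    |termField T₁ x i - termField T₂ x i| ≤ (IntervalD.mag (srcRow prec X (rrow RD (e i)))).toReal * δ := by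
  obtain ⟨hrows, hsame₁, hdata₁⟩ := h₁
  obtain ⟨-, hsame₂, hdata₂⟩ := h₂
  have hdiff : termField T₁ x i - termField T₂ x i =
      ((rows i).map fun k => (Tc k).coef * ((T₁ k).fa.val x * (T₁ k).fb.val x - (T₂ k).fa.val x * (T₂ k).fb.val x)).sum := by
    rw [termField, termField, ← Finset.sum_sub_distrib, ← hrows i]
    refine Finset.sum_congr rfl fun k _ => ?_
    rw [coefAt_eq_of_same hsame₁, coefAt_eq_of_same hsame₂]; ring
  obtain ⟨r, hr, hsum⟩ := exists_mem_srcRow_row e prec hδ hx (hdata₁ i) (hdata₂ i) ht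
  rw [hdiff, hsum, abs_mul, abs_of_nonneg hδ, mul_comm]
  exact mul_le_mul_of_nonneg_right (IntervalD.abs_le_mag hr) hδ

end Row

/-! ### The masked sensitivity step -/

/-- The real weight of a mask: `1` or `0`. [folklore] -/
def maskR (mk : ℕ → Bool) (c : ℕ) : ℝ := if mk c then 1 else 0

/-- `maskR ∈ {0, 1}`, in particular non-negative and at most one. [folklore] -/
theorem maskR_nonneg (mk : ℕ → Bool) (c : ℕ) : 0 ≤ maskR mk c := by
  unfold maskR; split_ifs <;> norm_num

namespace PairStepD

variable (d : PairStepD)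

/-- The masked source `src_c · [mk c]` as a dyadic (`src_c` or `0`). [folklore] -/
def srcM (mk : ℕ → Bool) (c : ℕ) : Dyad := if mk c then d.srcD c else Dyad.ofInt 0

/-- Its real value. [folklore] -/
theorem srcM_toReal (mk : ℕ → Bool) (c : ℕ) : (d.srcM mk c).toReal = (d.srcD c).toReal * maskR mk c := by
  unfold srcM maskR; split_ifs <;> simp

/-- **THE MASKED SENSITIVITY TEST OF ONE STEP**: non-negativity and the two K–Z vector fixed points
`((R_r ZB)_i + src_i [mW i] + (Ab pB)_i) E_r,i ≤ ZB_i`, `((R_r ZE)_i + src_i [mT i] + (Ab pE)_i) E_r,i ≤ ZE_i`.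
[cite: KapelaZgliczynski2009, §4 Lemma 8 / Thm. 9; cell vocabulary, harvest/h2-tao-ladder rung1/RUNG1-P2G16-REPORT.md §83 (Ẑ_b, Ẑ_e with sources β_b, β_e)] -/
def sensOKM (mW mT : ℕ → Bool) (pB ZB pE ZE : ℕ → Dyad) : Bool :=
  (List.range d.n).all fun i =>
    Dyad.ble (Dyad.ofInt 0) (pB i) && Dyad.ble (Dyad.ofInt 0) (ZB i) &&
    Dyad.ble (Dyad.ofInt 0) (pE i) && Dyad.ble (Dyad.ofInt 0) (ZE i) &&
    IntervalD.hiLe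
      (IntervalD.mulR d.prec
        (IntervalD.addR d.prec (d.rowDot (d.RrRow i) ZB)
          (IntervalD.addR d.prec (IntervalD.ofDyad (d.srcM mW i)) (d.rowDot (d.AbRow i) pB)))
        (IntervalD.ofDyad (d.ER i)))
      (ZB i) &&
    IntervalD.hiLe
      (IntervalD.mulR d.prec
        (IntervalD.addR d.prec (d.rowDot (d.RrRow i) ZE)
          (IntervalD.addR d.prec (IntervalD.ofDyad (d.srcM mT i)) (d.rowDot (d.AbRow i) pE)))
        (IntervalD.ofDyad (d.ER i)))
      (ZE i)

/-- What `sensOKM = true` says. [folklore] -/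
theorem of_sensOKM {mW mT : ℕ → Bool} {pB ZB pE ZE : ℕ → Dyad} (h : d.sensOKM mW mT pB ZB pE ZE = true) : ∀ i < d.n,
    0 ≤ (pB i).toReal ∧ 0 ≤ (ZB i).toReal ∧ 0 ≤ (pE i).toReal ∧ 0 ≤ (ZE i).toReal ∧
    IntervalD.hiLe
      (IntervalD.mulR d.prec
        (IntervalD.addR d.prec (d.rowDot (d.RrRow i) ZB)
          (IntervalD.addR d.prec (IntervalD.ofDyad (d.srcM mW i)) (d.rowDot (d.AbRow i) pB)))
        (IntervalD.ofDyad (d.ER i)))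
      (ZB i) = true ∧
    IntervalD.hiLe
      (IntervalD.mulR d.prec
        (IntervalD.addR d.prec (d.rowDot (d.RrRow i) ZE)
          (IntervalD.addR d.prec (IntervalD.ofDyad (d.srcM mT i)) (d.rowDot (d.AbRow i) pE)))
        (IntervalD.ofDyad (d.ER i)))
      (ZE i) = true := by
  unfold sensOKM at h
  simp only [Bool.and_eq_true, List.all_eq_true, List.mem_range] at h
  intro i hi
  obtain ⟨⟨⟨⟨⟨h1, h2⟩, h3⟩, h4⟩, h5⟩, h6⟩ := h i hi
  exact ⟨by simpa using (Dyad.ble_iff _ _).1 h1, by simpa using (Dyad.ble_iff _ _).1 h2,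
    by simpa using (Dyad.ble_iff _ _).1 h3, by simpa using (Dyad.ble_iff _ _).1 h4, h5, h6⟩

variable {ι : Type*} [Fintype ι] [DecidableEq ι] {κ : Type*} [Fintype κ] (e : ι ≃ Fin d.n)

/-- **THE MASKED TWO-RUN TAIL SENSITIVITY OF ONE STEP FROM THE DATA.** As part LXVIII `abs_sens_le`, with the twin
hypothesis ROW-WISE at distance `B·[mW (e i)] + E·[mT (e i)]` (`B, E ≥ 0`), start `|S_u(0) − S_v(0)|_i ≤ pB_i B + pE_i E`,
conclusion `|S_u(t) − S_v(t)|_i ≤ (pB_i + ZB_i) B + (pE_i + ZE_i) E` on `[0, h']`.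
[cite: KapelaZgliczynski2009, §4 Lemma 8 / Thm. 9; WalawskaWilczak2016, §2.2 Lemma 2; cell vocabulary, harvest/h2-tao-ladder rung1/RUNG1-P2G16-REPORT.md §83 (K2), rung1/KERNEL-CHEAP-REPLAY-SPEC.md §3 S5] -/
theorem abs_sensM_le {Tc : κ → BTerm ι} {Tf₁ Tf₂ : ℝ → κ → BTerm ι} {rows : ι → List κ}
    (hRDc : IsRTEncl e Tc Tc rows d.RD)
    {h' : ℝ} (hh' : h' ∈ Icc 0 d.hD.toReal)
    (hRD₁ : ∀ t ∈ Ico 0 h', IsRTEncl e Tc (Tf₁ t) rows d.RD)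
    (hRD₂ : ∀ t ∈ Ico 0 h', IsRTEncl e Tc (Tf₂ t) rows d.RD)
    {mW mT : ℕ → Bool} {B E : ℝ} (hB : 0 ≤ B) (hE : 0 ≤ E)
    (htwin : ∀ t ∈ Ico 0 h', ∀ i, ∀ k ∈ rows i,
      Factor.Twin (B * maskR mW (e i) + E * maskR mT (e i)) (Tf₁ t k).fa (Tf₂ t k).fa ∧
      Factor.Twin (B * maskR mW (e i) + E * maskR mT (e i)) (Tf₁ t k).fb (Tf₂ t k).fb)
    (hc : d.check = true) {pB ZB pE ZE : ℕ → Dyad} (hs : d.sensOKM mW mT pB ZB pE ZE = true)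
    (hmemH : ∀ x ∈ boxSet (boxOf e d.Hs), ∀ i, IntervalD.mem (x i) (IntervalD.aget d.Hs (e i)))
    {Su Sv : ℝ → ι → ℝ}
    (hSu : ∀ t ∈ Icc 0 h', HasDerivWithinAt Su (termField (Tf₁ t) (Su t)) (Icc 0 h') t)
    (hSv : ∀ t ∈ Icc 0 h', HasDerivWithinAt Sv (termField (Tf₂ t) (Sv t)) (Icc 0 h') t)
    (hmem : ∀ t ∈ Ico 0 h', Su t ∈ boxSet (boxOf e d.Hs) ∧ Sv t ∈ boxSet (boxOf e d.Hs))
    (h0 : ∀ i, |Su 0 i - Sv 0 i| ≤ (pB (e i)).toReal * B + (pE (e i)).toReal * E) :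
    ∀ t ∈ Icc 0 h', ∀ i, |Su t i - Sv t i| ≤
      ((pB (e i)).toReal + (ZB (e i)).toReal) * B + ((pE (e i)).toReal + (ZE (e i)).toReal) * E := by
  classical
  have hc' : d.toRoughStepD.check = true ∧ d.checkPair = true := by simpa [check, Bool.and_eq_true] using hc
  obtain ⟨hrc, hpc⟩ := hc'
  have hrc' : d.toRoughStepD.centre.check = true ∧ d.toRoughStepD.checkKZ = true := by
    simpa [RoughStepD.check, Bool.and_eq_true] using hrc
  have hcw := d.toRoughStepD.centre.of_checkWith (by rw [← CentreStepD.check_eq]; exact hrc'.1)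
  have hh : 0 ≤ d.hD.toReal := hcw.2.1
  have hP := d.of_checkPair hpc
  have hS := d.of_sensOKM hs
  have hrow : ∀ i, List.Forall₂ (fun dd k => TermOK e dd (Tc k) (Tc k)) (d.row (e i)) (rows i) := d.rowOK e hRDc
  have hvAb : ∀ i, ∀ p ∈ d.AbRow (e i), p.1 < d.n := fun i => fst_lt_of_mem_magRow e d.prec (RFac.rval d.Hs) (hrow i)
  have hvRr : ∀ i, ∀ p ∈ d.RrRow (e i), p.1 < d.n := fun i => fst_lt_of_mem_filter (hvAb i) _
  -- rough data, read through `e`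
  let dgr : ι → ℝ := fun i => (d.dgR (e i)).toReal
  let Rr : ι → ι → ℝ := fun i j => colVal (d.RrRow (e i)) (e j)
  let Ab : ι → ι → ℝ := fun i j => colVal (d.AbRow (e i)) (e j)
  let Er : ι → ℝ := fun i => (d.ER (e i)).toReal
  let ζr : ι → ℝ := fun i => (RoughStepD.dget d.zetaR (e i)).toReal
  let cb : ι → ℝ := fun i => (d.srcM mW (e i)).toReal
  let ce : ι → ℝ := fun i => (d.srcM mT (e i)).toReal
  let pBr : ι → ℝ := fun i => (pB (e i)).toReal
  let ZBr : ι → ℝ := fun i => (ZB (e i)).toReal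
  let pEr : ι → ℝ := fun i => (pE (e i)).toReal
  let ZEr : ι → ℝ := fun i => (ZE (e i)).toReal
  -- sparse products
  have hsumRr : ∀ i (g : ℕ → Dyad), IntervalD.mem (∑ j, Rr i j * (g (e j)).toReal) (d.rowDot (d.RrRow (e i)) g) := by
    intro i g
    have hs' := sum_colVal_mul e (fun c => (g c).toReal) (hvRr i)
    show IntervalD.mem (∑ j, colVal (d.RrRow (e i)) (e j) * (g (e j)).toReal) _
    rw [hs']
    exact d.mem_rowDot g (d.RrRow (e i))
  have hsumAb : ∀ i (g : ℕ → Dyad), IntervalD.mem (∑ j, Ab i j * (g (e j)).toReal) (d.rowDot (d.AbRow (e i)) g) := by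
    intro i g
    have hs' := sum_colVal_mul e (fun c => (g c).toReal) (hvAb i)
    show IntervalD.mem (∑ j, colVal (d.AbRow (e i)) (e j) * (g (e j)).toReal) _
    rw [hs']
    exact d.mem_rowDot g (d.AbRow (e i))
  -- Jacobian bounds of the first realisation on the hull
  have hdg : ∀ t ∈ Ico 0 h', ∀ x ∈ boxSet (boxOf e d.Hs), ∀ i,
      (termFieldDeriv (Tf₁ t) x) (Pi.single i 1) i ≤ dgr i := by
    intro t ht x hx i
    rw [termFieldDeriv_single]
    exact (mem_jacEntry_jacRowR e (hRD₁ t ht) d.prec (hmemH _ hx) i i).2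
  have hR : ∀ t ∈ Ico 0 h', ∀ x ∈ boxSet (boxOf e d.Hs), ∀ i j, i ≠ j →
      |(termFieldDeriv (Tf₁ t) x) (Pi.single j 1) i| ≤ Rr i j := by
    intro t ht x hx i j hij
    rw [termFieldDeriv_single]
    show |jacEntry (Tf₁ t) x i j| ≤ colVal (d.RrRow (e i)) (e j)
    rw [PairStepD.RrRow, colVal_filter_ne (fun h'' => hij (e.injective (Fin.ext h'')).symm)]
    exact abs_jacEntry_le_colVal_rough e (hRD₁ t ht) d.prec (hmemH _ hx) i j
  have hAbb : ∀ t ∈ Ico 0 h', ∀ x ∈ boxSet (boxOf e d.Hs), ∀ i j,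
      |(termFieldDeriv (Tf₁ t) x) (Pi.single j 1) i| ≤ Ab i j := by
    intro t ht x hx i j
    rw [termFieldDeriv_single]
    exact abs_jacEntry_le_colVal_rough e (hRD₁ t ht) d.prec (hmemH _ hx) i j
  -- the masked twin field difference on the hull
  have hδf : ∀ t ∈ Ico 0 h', ∀ x ∈ boxSet (boxOf e d.Hs), ∀ i,
      |termField (Tf₁ t) x i - termField (Tf₂ t) x i| ≤ cb i * B + ce i * E := by
    intro t ht x hx i
    have hδ0 : 0 ≤ B * maskR mW (e i) + E * maskR mT (e i) :=
      add_nonneg (mul_nonneg hB (maskR_nonneg _ _)) (mul_nonneg hE (maskR_nonneg _ _))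
    have h1 := abs_termField_twin_sub_le_row e (hRD₁ t ht) (hRD₂ t ht) hδ0 i (htwin t ht i) d.prec (hmemH _ hx)
    change |termField (Tf₁ t) x i - termField (Tf₂ t) x i| ≤ (d.srcD (e i)).toReal * _ at h1
    have hcb : cb i = (d.srcD (e i)).toReal * maskR mW (e i) := d.srcM_toReal mW (e i)
    have hce : ce i = (d.srcD (e i)).toReal * maskR mT (e i) := d.srcM_toReal mT (e i)
    rw [hcb, hce]
    refine h1.trans (le_of_eq ?_)
    ring
  -- weights and direction
  have hEr : ∀ i, gronwallBound 0 (dgr i) 1 h' ≤ Er i := by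
    intro i
    have hx := (hP (e i) (e i).isLt).2.1
    simp only [PairStepD.xplusR, Dyad.toReal_max, Dyad.toReal_mul, Dyad.toReal_ofInt, Int.cast_zero, max_le_iff] at hx
    refine (gronwallBound_mono_time hh'.2).trans ((gronwallBound_le_lin hh hx.1).trans (le_of_eq ?_))
    simp only [Er, PairStepD.ER, PairStepD.xplusR, Dyad.toReal_mul, Dyad.toReal_add, Dyad.toReal_max, Dyad.toReal_ofInt]
    push_cast; ring
  have hdir : ∀ i, (∑ j, Rr i j * ζr j) * Er i ≤ ζr i := by
    intro i
    have hok := (hP (e i) (e i).isLt).2.2.2.1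
    exact IntervalD.le_of_hiLe hok (IntervalD.mem_mulR d.prec (hsumRr i (RoughStepD.dget d.zetaR)) (IntervalD.mem_ofDyad _))
  -- the two fixed points
  have hfixB : ∀ i, ((∑ j, Rr i j * ZBr j) + (cb i + ∑ j, Ab i j * pBr j)) * Er i ≤ ZBr i := by
    intro i
    have hok := (hS (e i) (e i).isLt).2.2.2.2.1
    exact IntervalD.le_of_hiLe hok (IntervalD.mem_mulR d.prec
      (IntervalD.mem_addR d.prec (hsumRr i ZB) (IntervalD.mem_addR d.prec (IntervalD.mem_ofDyad _) (hsumAb i pB)))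
      (IntervalD.mem_ofDyad _))
  have hfixE : ∀ i, ((∑ j, Rr i j * ZEr j) + (ce i + ∑ j, Ab i j * pEr j)) * Er i ≤ ZEr i := by
    intro i
    have hok := (hS (e i) (e i).isLt).2.2.2.2.2
    exact IntervalD.le_of_hiLe hok (IntervalD.mem_mulR d.prec
      (IntervalD.mem_addR d.prec (hsumRr i ZE) (IntervalD.mem_addR d.prec (IntervalD.mem_ofDyad _) (hsumAb i pE)))
      (IntervalD.mem_ofDyad _))
  -- part XVII
  have hres := abs_stepSensitivity_le (ι := ι) (h := h') hh'.1 (convex_boxSet (boxOf e d.Hs))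
    (f := fun t x => termField (Tf₁ t) x) (f₂ := fun t x => termField (Tf₂ t) x)
    (f' := fun t x => termFieldDeriv (Tf₁ t) x) (S := Su) (S₂ := Sv) hSu hSv hmem
    (fun t _ x _ => hasFDerivWithinAt_termField (Tf₁ t) (boxSet (boxOf e d.Hs)) x)
    (dg := dgr) (cb := cb) (ce := ce) (pb := pBr) (pe := pEr) (Zb := ZBr) (Ze := ZEr) (Ew := Er) (ζ := ζr)
    (R := Rr) (Ab := Ab) (B := B) (E := E) hB hE hdg
    (fun i j => colVal_filter_nonneg (snd_nonneg_of_mem_magRow d.prec _ _) _ _) hR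
    (fun i j => colVal_magRow_nonneg d.prec _ _ _) hAbb
    (fun i => by
      show 0 ≤ (d.srcM mW (e i)).toReal
      rw [d.srcM_toReal]; exact mul_nonneg (srcRow_mag_nonneg d.prec d.Hs (d.row (e i))) (maskR_nonneg _ _))
    (fun i => by
      show 0 ≤ (d.srcM mT (e i)).toReal
      rw [d.srcM_toReal]; exact mul_nonneg (srcRow_mag_nonneg d.prec d.Hs (d.row (e i))) (maskR_nonneg _ _))
    (fun i => (hS (e i) (e i).isLt).1) (fun i => (hS (e i) (e i).isLt).2.2.1) h0 hδf
    (fun i => (hS (e i) (e i).isLt).2.1) (fun i => (hS (e i) (e i).isLt).2.2.2.1) hEr hfixB hfixE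
    (fun i => (hP (e i) (e i).isLt).1) hdir
  intro t ht i
  exact hres t ht i

end PairStepD

end DSSOneShift

end Summit.NavierStokesRegularity.NavierStokesRegularity.Theorems
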